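import Summits.PneNP.PneNP.Theorems.OneSliceSliceACZeroWindow
import Summits.PneNP.PneNP.Theorems.SliceACZero.Negative.DeltaBeforeK

/-!
# Birth skeleton of the forward rung `SliceACZeroParity` (next rung of stmt-PneNP-2835 `SliceACZero`)

`SliceACZeroParity := SliceDescent accTwoClass` — window-uniform average-case hardness of `CLIQUE_k` for
depth-`d` poly-size **AC⁰[⊕]** circuits under `G(n,q)` DESCENDS to every central slice `G(n,j)`.

The floor's proof (`RussoWindowLadder.sliceACZero_proof`) dies at `boppana` (total influence of AC⁰ is polylog):
a single parity gate has `q·I_q ≍ j` and distinguishes the slice from the product measure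
(`Theorems/SliceACZero/Negative/SliceIndistParity.lean: not_sliceIndistNoDepth` is the in-tree witness that
same-circuit indistinguishability is depth-load-bearing).  New mechanism: CHANGE the circuit —
`C' := C ∘ adj_{π,t}` deletes/adds the `< 2^t` canonically-π-ordered edges needed to reach the residue class
`|y| ≡ j (mod 2^t)` (AC⁰ can count to `2^t = polylog`), and the remaining claim is COMB INDISTINGUISHABILITY
(`stub_combIndist`): a poly-size AC⁰[⊕] circuit cannot tell slice `j` from slice `j' ≡ j (mod 2^t)`,
`|j' - j| ≤ √j·log j`, once `2^t` exceeds its Razborov–Smolensky degree `(log n)^{O(d)}` (Lucas/Hegedűs periodicity of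
low F₂-degree polynomials across slices; robust version: Srinivasan, TheoretiCS 2023 Lemma 3.1; coin problem in
AC⁰[⊕]: Limaye–Sreenivasaiah–Srinivasan–Tripathi–Venkitesh arXiv:1809.04092).  Clique edit-stability and Chebyshev
on `Bin(C(n,2), j/C(n,2))`, then averaging over `π` (Adleman) give the transport `stub_sliceTransport`; the
composition `SliceACZeroParity_of` below is kernel-checked (sorries only in `stub_*`).
-/

noncomputable section

set_option linter.dupNamespace false

namespace Summit.PneNP.PneNP.Cruxes.SliceACZero.ClassDescent

open scoped BigOperators Classical
open Finset Filter Literature.Computability.Complexity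
open Summit.PneNP.PneNP.Theorems.SliceACZero.Negative (mk sliceCard sliceErr sliceCard_eq)
open Summit.PneNP.PneNP.Cruxes.SliceACZero.RussoWindowLadder (window_eventually)

/-! ### The graded family (verbatim from `Sketch.lean`) -/

def Hyp (𝒞 : ℕ → (n : ℕ) → Circuit ((⊤ : SimpleGraph (Fin n)).edgeSet) → Prop) : Prop :=
  ∀ d c : ℕ, ∃ k : ℕ, 3 ≤ k ∧ ∃ δ : ℝ, 0 < δ ∧ ∀ᶠ n : ℕ in Filter.atTop, ∀ q : ℝ, 0 ≤ q → q ≤ 1 →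
    |q * (n.choose 2 : ℕ) - (⌊((n.choose 2 : ℕ) : ℝ) * (n : ℝ) ^ (-(2 : ℝ) / ((k : ℝ) - 1))⌋₊ : ℝ)| ≤
      (⌊((n.choose 2 : ℕ) : ℝ) * (n : ℝ) ^ (-(2 : ℝ) / ((k : ℝ) - 1))⌋₊ : ℝ) ^ ((3 : ℝ) / 4) →
    ∀ C : Circuit ((⊤ : SimpleGraph (Fin n)).edgeSet), 𝒞 d n C →
      (Finset.univ.filter (fun x : ((⊤ : SimpleGraph (Fin n)).edgeSet) → Bool =>
          C.eval x ≠ decide (¬ (SimpleGraph.fromEdgeSet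
            {e : Sym2 (Fin n) | ∃ h : e ∈ (⊤ : SimpleGraph (Fin n)).edgeSet, x ⟨e, h⟩ = true}).CliqueFree k))).sum
        (fun x => (q) ^ (Finset.univ.filter (fun e => x e = true)).card *
          (1 - q) ^ (n.choose 2 - (Finset.univ.filter (fun e => x e = true)).card)) ≤ δ →
      n ^ c < C.size

def Conc (𝒞 : ℕ → (n : ℕ) → Circuit ((⊤ : SimpleGraph (Fin n)).edgeSet) → Prop) : Prop :=
  ∀ d c : ℕ, ∃ k : ℕ, 3 ≤ k ∧ ∃ δ : ℝ, 0 < δ ∧ ∀ᶠ n : ℕ in Filter.atTop, ∀ j : ℕ,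
    |(j : ℝ) - (⌊((n.choose 2 : ℕ) : ℝ) * (n : ℝ) ^ (-(2 : ℝ) / ((k : ℝ) - 1))⌋₊ : ℝ)| ≤
      (⌊((n.choose 2 : ℕ) : ℝ) * (n : ℝ) ^ (-(2 : ℝ) / ((k : ℝ) - 1))⌋₊ : ℝ) ^ ((3 : ℝ) / 4) →
    ∀ C : Circuit ((⊤ : SimpleGraph (Fin n)).edgeSet), 𝒞 d n C →
      ((Finset.univ.filter (fun x : ((⊤ : SimpleGraph (Fin n)).edgeSet) → Bool =>
          (Finset.univ.filter (fun e => x e = true)).card = j ∧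
          C.eval x ≠ decide (¬ (SimpleGraph.fromEdgeSet
            {e : Sym2 (Fin n) | ∃ h : e ∈ (⊤ : SimpleGraph (Fin n)).edgeSet, x ⟨e, h⟩ = true}).CliqueFree k))).card : ℝ) ≤
        δ * ((Finset.univ.filter (fun x : ((⊤ : SimpleGraph (Fin n)).edgeSet) → Bool =>
          (Finset.univ.filter (fun e => x e = true)).card = j)).card : ℝ) →
      n ^ c < C.size

def SliceDescent (𝒞 : ℕ → (n : ℕ) → Circuit ((⊤ : SimpleGraph (Fin n)).edgeSet) → Prop) : Prop :=
  Hyp 𝒞 → Conc 𝒞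

def accTwoClass : ℕ → (n : ℕ) → Circuit ((⊤ : SimpleGraph (Fin n)).edgeSet) → Prop :=
  fun d _ C => C.IsOver (accBasis 2) ∧ C.acDepth ≤ d

/-- THE RUNG. -/
def SliceACZeroParity : Prop := SliceDescent accTwoClass

/-! ### Read-back in the Disproof vocabulary (`mk`, `sliceErr`, `sliceCard`, `gnpDisagreeProb`, `cliqueFn`) -/

theorem hyp_iff (𝒞 : ℕ → (n : ℕ) → Circuit ((⊤ : SimpleGraph (Fin n)).edgeSet) → Prop) :
    Hyp 𝒞 ↔ ∀ d c : ℕ, ∃ k : ℕ, 3 ≤ k ∧ ∃ δ : ℝ, 0 < δ ∧ (∀ᶠ n : ℕ in atTop, ∀ q : ℝ, 0 ≤ q → q ≤ 1 →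
        |q * (n.choose 2 : ℕ) - (mk n k : ℝ)| ≤ (mk n k : ℝ) ^ ((3 : ℝ) / 4) →
        ∀ C : Circuit ((⊤ : SimpleGraph (Fin n)).edgeSet), 𝒞 d n C →
          gnpDisagreeProb n q C.eval (cliqueFn n k) ≤ δ → n ^ c < C.size) :=
  Iff.rfl

theorem conc_iff (𝒞 : ℕ → (n : ℕ) → Circuit ((⊤ : SimpleGraph (Fin n)).edgeSet) → Prop) :
    Conc 𝒞 ↔ ∀ d c : ℕ, ∃ k : ℕ, 3 ≤ k ∧ ∃ δ : ℝ, 0 < δ ∧ (∀ᶠ n : ℕ in atTop, ∀ j : ℕ,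
        |(j : ℝ) - (mk n k : ℝ)| ≤ (mk n k : ℝ) ^ ((3 : ℝ) / 4) →
        ∀ C : Circuit ((⊤ : SimpleGraph (Fin n)).edgeSet), 𝒞 d n C →
          (sliceErr n j C.eval (cliqueFn n k) : ℝ) ≤ δ * sliceCard n j → n ^ c < C.size) :=
  Iff.rfl

/-! ### Stubs -/

/-- **stub_combIndist (L; the genuinely new invariance principle, load-bearing INSIDE `stub_sliceTransport`; typed
here for the record and for refuters — the composition consumes only the transport).**  For every depth `d`, size
exponent `c` and `ε > 0` there are an exponent `a` and a scale `t : ℕ → ℕ` with `2^{t n} ≤ (log₂ n)^a` (so that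
AC⁰ can perform the residue adjustment) such that, eventually in `n`, a depth-`d` AC⁰[⊕] circuit with `≤ n^c`
gates accepts the uniform points of two central slices `j ≤ j'` with `2^{t n} ∣ j' - j` with probabilities within
`ε` (acceptance written as `sliceErr` against the constant `false`).  Why it might fail: an AC⁰[⊕] circuit might
read more of `|x|` than its low-order bits and coin-problem-scale information — e.g. if the approximate F₂-degree
of the `t`-th bit of `|x|` on slice pairs were only `polylog · 2^{t/2}`; sources: Srinivasan TheoretiCS 2023
Lemma 3.1 (robust Hegedűs), LSSTV arXiv:1809.04092, Smolensky 1987. -/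
theorem stub_combIndist :
    ∀ d c : ℕ, ∀ ε : ℝ, 0 < ε → ∃ a : ℕ, ∃ t : ℕ → ℕ, (∀ᶠ n : ℕ in atTop, 2 ^ t n ≤ Nat.log 2 n ^ a) ∧
      ∀ k : ℕ, 3 ≤ k → ∀ᶠ n : ℕ in atTop, ∀ j j' : ℕ,
        |(j : ℝ) - (mk n k : ℝ)| ≤ (mk n k : ℝ) ^ ((3 : ℝ) / 4) →
        |(j' : ℝ) - (mk n k : ℝ)| ≤ (mk n k : ℝ) ^ ((3 : ℝ) / 4) → j ≤ j' → 2 ^ t n ∣ j' - j →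
        ∀ C : Circuit ((⊤ : SimpleGraph (Fin n)).edgeSet), accTwoClass d n C → C.size ≤ n ^ c →
          |(sliceErr n j C.eval (fun _ => false) : ℝ) / (sliceCard n j : ℝ) -
            (sliceErr n j' C.eval (fun _ => false) : ℝ) / (sliceCard n j' : ℝ)| ≤ ε := by
  sorry

/-- **stub_sliceTransport (L; heart as consumed by the composition).**  Slice-accuracy transports to
product-accuracy INSIDE AC⁰[⊕] with polynomial overhead: for every `(d, c)` there are `(d', a)` such that for
every `k ≥ 3`, `ε > 0`, eventually in `n`, for every central `j` and every depth-`d` AC⁰[⊕] circuit `C` with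
`≤ n^c` gates there is a depth-`d'` AC⁰[⊕] circuit `C'` with `≤ n^a` gates whose `G(n, j/C(n,2))`-error against
`CLIQUE_k` is at most twice the slice-`j` error rate of `C` plus `ε`.  Intended `C' = C ∘ adj_{π₀,t}` (residue
adjustment, `stub_combIndist` applied to the test circuit `[C ≠ CLIQUE_k]`, clique edit-stability under deletion /
addition of `< 2^t` π-random edges, Chebyshev, averaging over `π`).  Why it might fail: only through
`stub_combIndist`. -/
theorem stub_sliceTransport :
    ∀ d c : ℕ, ∃ d' a : ℕ, ∀ k : ℕ, 3 ≤ k → ∀ ε : ℝ, 0 < ε → ∀ᶠ n : ℕ in atTop, ∀ j : ℕ,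
      |(j : ℝ) - (mk n k : ℝ)| ≤ (mk n k : ℝ) ^ ((3 : ℝ) / 4) →
      ∀ C : Circuit ((⊤ : SimpleGraph (Fin n)).edgeSet), accTwoClass d n C → C.size ≤ n ^ c →
        ∃ C' : Circuit ((⊤ : SimpleGraph (Fin n)).edgeSet), accTwoClass d' n C' ∧ C'.size ≤ n ^ a ∧
          gnpDisagreeProb n ((j : ℝ) / ((n.choose 2 : ℕ) : ℝ)) C'.eval (cliqueFn n k) ≤
            2 * ((sliceErr n j C.eval (cliqueFn n k) : ℝ) / (sliceCard n j : ℝ)) + ε := by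
  sorry

/-! ### The composition (kernel-checked: the rung from the transport stub) -/

/-- `stub_sliceTransport → SliceACZeroParity`: given `Hyp` and `(d, c)`, take `(d', a)` from the transport and
`(k, δ_H)` from `Hyp d' a`; answer `Conc` with `k` and `δ := δ_H / 4`.  For large `n`, a central `j` and a
slice-accurate `C` with `≤ n^c` gates would transport to a `G(n, j/C(n,2))`-accurate `C'` with `≤ n^a` gates,
contradicting `Hyp` at `q = j / C(n,2)` (window clause verbatim). -/
theorem SliceACZeroParity_of
    (hT : ∀ d c : ℕ, ∃ d' a : ℕ, ∀ k : ℕ, 3 ≤ k → ∀ ε : ℝ, 0 < ε → ∀ᶠ n : ℕ in atTop, ∀ j : ℕ,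
      |(j : ℝ) - (mk n k : ℝ)| ≤ (mk n k : ℝ) ^ ((3 : ℝ) / 4) →
      ∀ C : Circuit ((⊤ : SimpleGraph (Fin n)).edgeSet), accTwoClass d n C → C.size ≤ n ^ c →
        ∃ C' : Circuit ((⊤ : SimpleGraph (Fin n)).edgeSet), accTwoClass d' n C' ∧ C'.size ≤ n ^ a ∧
          gnpDisagreeProb n ((j : ℝ) / ((n.choose 2 : ℕ) : ℝ)) C'.eval (cliqueFn n k) ≤
            2 * ((sliceErr n j C.eval (cliqueFn n k) : ℝ) / (sliceCard n j : ℝ)) + ε) :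
    SliceACZeroParity := by
  show Hyp accTwoClass → Conc accTwoClass
  rw [hyp_iff, conc_iff]
  intro hH d c
  obtain ⟨d', a, hT'⟩ := hT d c
  obtain ⟨k, hk3, δH, hδH, hHyp⟩ := hH d' a
  refine ⟨k, hk3, δH / 4, by positivity, ?_⟩
  filter_upwards [hHyp, hT' k hk3 (δH / 4) (by positivity), window_eventually hk3 5,
    eventually_ge_atTop 2] with n hn hTn hw hn2 j hj C hC herr
  obtain ⟨hj5, hnj, h2j⟩ := hw j hj
  by_contra hbig
  have hs : C.size ≤ n ^ c := not_lt.1 hbig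
  obtain ⟨C', hC', hs', herr'⟩ := hTn j hj C hC hs
  -- the slice-error rate of `C` is at most `δ_H / 4`
  have hjN : j ≤ n.choose 2 := by omega
  have hcardpos : (0 : ℝ) < (sliceCard n j : ℝ) := by
    rw [sliceCard_eq]
    exact_mod_cast Nat.choose_pos hjN
  have hratio : (sliceErr n j C.eval (cliqueFn n k) : ℝ) / (sliceCard n j : ℝ) ≤ δH / 4 :=
    (div_le_iff₀ hcardpos).2 herr
  have hgnp : gnpDisagreeProb n ((j : ℝ) / ((n.choose 2 : ℕ) : ℝ)) C'.eval (cliqueFn n k) ≤ δH := by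
    linarith
  -- fire `Hyp` at `q = j / C(n,2)` on `C'`
  have hNpos : (0 : ℝ) < ((n.choose 2 : ℕ) : ℝ) := by exact_mod_cast (show 0 < n.choose 2 by omega)
  have hq0 : 0 ≤ (j : ℝ) / ((n.choose 2 : ℕ) : ℝ) := div_nonneg (Nat.cast_nonneg _) hNpos.le
  have hq1 : (j : ℝ) / ((n.choose 2 : ℕ) : ℝ) ≤ 1 := by
    rw [div_le_one hNpos]; exact_mod_cast hjN
  have hqw : |(j : ℝ) / ((n.choose 2 : ℕ) : ℝ) * ((n.choose 2 : ℕ) : ℝ) - (mk n k : ℝ)| ≤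
      (mk n k : ℝ) ^ ((3 : ℝ) / 4) := by
    rw [div_mul_cancel₀ _ hNpos.ne']; exact hj
  have hlt : n ^ a < C'.size := hn _ hq0 hq1 hqw C' hC' hgnp
  exact absurd hs' (not_le.2 hlt)

/-- The registered form: the rung from the named stub. -/
theorem sliceACZeroParity_of_stubs : SliceACZeroParity :=
  SliceACZeroParity_of stub_sliceTransport

end Summit.PneNP.PneNP.Cruxes.SliceACZero.ClassDescent

end
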